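import Summits.NavierStokesRegularity.NavierStokesRegularity.Theses.PumpContinuation
import Summits.NavierStokesRegularity.NavierStokesRegularity.Theorems.PumpContinuationEulerProximatePumpDoorOfAccumulating
import Summits.NavierStokesRegularity.NavierStokesRegularity.Theorems.PumpContinuationEulerProximatePumpAccumulatingOfDoor
import Summits.NavierStokesRegularity.NavierStokesRegularity.Theorems.PumpContinuationEulerProximatePumpTransfer

/-!
# Crux `EulerProximatePump` (stmt-NavierStokesRegularity-18302) — strategist's typed cut (STRATEGY-CENSUS §Decomposition, §Strengthen)

Evidence file of the crux-strategist seat (wall-breaker, gen 1). Nothing here is proposed to `Theorems/`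
(it closes no item and registers no stub); it CERTIFIES the signatures quoted in `STRATEGY-CENSUS.md`:

* `HotBooster` / `BoosterTempering` — the best typed split of the Door the seat could produce, with the
  kernel-checked join `EulerProximatePump_of_subs : HotBooster → BoosterTempering → EulerProximatePump`
  and the position lemmas `hotBooster_of_door : EulerProximatePump → HotBooster`,
  `hotBooster_of_nsTypeI : NSTypeI → HotBooster` (so `HotBooster` is a CONSEQUENCE of the crux, strictly on the
  averaged side; `BoosterTempering` is the class-wide a-priori temperature bound = the Navier–Stokes residue).
* `IntervalDoor`, `MonotoneCooling` — the two strengthenings S⁺ examined under §Strengthen, with the routine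
  implications to the Door (`door_of_intervalDoor`, `door_of_monotoneCooling`).

Notation: `boost 𝒜 η = B + η·B̃_𝒜` (the accumulation normal form of the segment, landed
`pumpContinuation_eulerProximatePump_iff_accumulating`, p146213/p146216); `TypeIBlowupFor T M` = the crux's matrix
`tIB[T, M]` (Schwartz datum, `H¹⁰_df`-mild on `[0,S)`, Type-I at ceiling `M`, no mild extension).
-/

noncomputable section

-- the nested summit namespace `…NavierStokesRegularity.NavierStokesRegularity…` is the tree's layout (D-0017)
set_option linter.dupNamespace false

open MeasureTheory Set Filter
open scoped ENNReal
open Literature.Analysis.FluidPDE Literature.Analysis.FluidPDE.Tao2016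

namespace Summit.NavierStokesRegularity.NavierStokesRegularity.Cruxes.EulerProximatePump.Strategist

open Summit.NavierStokesRegularity.NavierStokesRegularity.Theses
open Summit.NavierStokesRegularity.NavierStokesRegularity.Theorems
open Summit.NavierStokesRegularity.NavierStokesRegularity.Theorems.PumpContinuationEulerProximatePump

/-- The boosted Navier–Stokes form `B + η·B̃_𝒜`. -/
def boost (𝒜 : AveragingDatum) (η : ℝ) : L2C → L2C → L2C → ℂ :=
  fun a b c => eulerForm a b c + ((η : ℝ) : ℂ) * 𝒜.form a b c

/-- The crux's matrix `tIB[T, M]`: a Schwartz-data `H¹⁰_df`-mild solution of `∂ₜu = Δu + T(u,u)` on `[0,S)`,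
Type-I at ceiling `M`, with no mild extension past `S`. -/
def TypeIBlowupFor (T : L2C → L2C → L2C → ℂ) (M : ℝ) : Prop :=
  ∃ u₀ : SchwartzMap (EuclideanSpace ℝ (Fin 3)) (EuclideanSpace ℝ (Fin 3)),
    VectorCalculus.IsDivFree ⇑u₀ ∧ ∃ S : ℝ, 0 < S ∧ ∃ u : ℝ → L2C,
      IsMildSolutionFor T (schwartzL2 u₀) (Ico 0 S) u ∧
      (∀ t ∈ Ico 0 S, eLpNorm (u t) ⊤ volume ≤ ENNReal.ofReal (M / Real.sqrt (S - t))) ∧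
      ¬ ∃ S' : ℝ, S < S' ∧ ∃ v : ℝ → L2C,
          IsMildSolutionFor T (schwartzL2 u₀) (Ico 0 S') v ∧ ∀ t ∈ Ico 0 S, v t = u t

/-- `HotNearEuler 𝒜`: the small boosts `B + ηB̃_𝒜` of Navier–Stokes are hot for parameters `η` accumulating at
`0⁺`, at SOME ceiling per parameter (temperature free). -/
def HotNearEuler (𝒜 : AveragingDatum) : Prop :=
  ∀ η₀ : ℝ, 0 < η₀ → ∃ η : ℝ, 0 < η ∧ η < η₀ ∧ ∃ M' : ℝ, TypeIBlowupFor (boost 𝒜 η) M'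

/-- `DoorFor 𝒜`: the Door's accumulation normal form for the fixed datum `𝒜` (one ceiling `M` for a sequence
`η → 0⁺`). -/
def DoorFor (𝒜 : AveragingDatum) : Prop :=
  ∃ M : ℝ, ∀ η₀ : ℝ, 0 < η₀ → ∃ η : ℝ, 0 < η ∧ η < η₀ ∧ TypeIBlowupFor (boost 𝒜 η) M

/-- **Sub₁ (averaged side).** Some symmetric cancelling datum has hot small boosts of Navier–Stokes
(blow-up ACCUMULATES at the Euler form inside Tao's class, temperature free). A consequence of the Door
(`hotBooster_of_door`), not known, not summit-deciding. -/
def HotBooster : Prop :=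
  ∃ 𝒜 : AveragingDatum, 𝒜.IsSymmetric ∧ 𝒜.HasCancellation ∧ HotNearEuler 𝒜

/-- **Sub₂ (Navier–Stokes side: the a-priori temperature bound, class-wide).** Every symmetric cancelling
datum whose small boosts are hot infinitely often near `0` has them hot at ONE ceiling along a sequence. -/
def BoosterTempering : Prop :=
  ∀ 𝒜 : AveragingDatum, 𝒜.IsSymmetric → 𝒜.HasCancellation → HotNearEuler 𝒜 → DoorFor 𝒜

/-- `DoorFor 𝒜 ⇒ Door` (landed accumulation normal form `stub_doorOfAccumulating`, p146216). [folklore] -/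
theorem door_of_doorFor {𝒜 : AveragingDatum} (hs : 𝒜.IsSymmetric) (hc : 𝒜.HasCancellation)
    (h : DoorFor 𝒜) : PumpContinuation.EulerProximatePump :=
  stub_doorOfAccumulating ⟨𝒜, hs, hc, h⟩

/-- **The typed cut**: `HotBooster → BoosterTempering → EulerProximatePump` (modus ponens + p146216). [folklore] -/
theorem EulerProximatePump_of_subs (h₁ : HotBooster) (h₂ : BoosterTempering) :
    PumpContinuation.EulerProximatePump := by
  obtain ⟨𝒜, hs, hc, hhot⟩ := h₁
  exact door_of_doorFor hs hc (h₂ 𝒜 hs hc hhot)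

/-- **`HotBooster` is a consequence of the Door** (landed `stub_accumulatingOfDoor`, p146213). [folklore] -/
theorem hotBooster_of_door (h : PumpContinuation.EulerProximatePump) : HotBooster := by
  obtain ⟨𝒜, hs, hc, M, hM⟩ := stub_accumulatingOfDoor h
  refine ⟨𝒜, hs, hc, fun η₀ hη₀ => ?_⟩
  obtain ⟨η, hη, hηη₀, hw⟩ := hM η₀ hη₀
  exact ⟨η, hη, hηη₀, M, hw⟩

/-- **`HotBooster` is implied by NSTypeI** (`𝒜 := euler`, landed `pumpContinuation_eulerProximatePump_of_nsTypeI`,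
p146155) — so, like the Door, it is cheap in the world the route bets on; unlike the Door it is not bounded
below by a Liouville failure. [folklore] -/
theorem hotBooster_of_nsTypeI (h : ∃ M : ℝ, TypeIBlowupFor eulerForm M) : HotBooster :=
  hotBooster_of_door (pumpContinuation_eulerProximatePump_of_nsTypeI h)

/-! ## §Strengthen: the two S⁺ examined -/

/-- **S⁺₁ (interval Door, = card conley-door's `RobustNSTypeI`)**: hot at one ceiling on a whole interval
`(0, η₁)`. -/
def IntervalDoor : Prop :=
  ∃ 𝒜 : AveragingDatum, 𝒜.IsSymmetric ∧ 𝒜.HasCancellation ∧ ∃ M η₁ : ℝ, 0 < η₁ ∧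
    ∀ η : ℝ, 0 < η → η < η₁ → TypeIBlowupFor (boost 𝒜 η) M

/-- `IntervalDoor → Door` (an interval contains a sequence). [folklore] -/
theorem door_of_intervalDoor (h : IntervalDoor) : PumpContinuation.EulerProximatePump := by
  obtain ⟨𝒜, hs, hc, M, η₁, hη₁, hM⟩ := h
  refine door_of_doorFor hs hc ⟨M, fun η₀ hη₀ => ?_⟩
  refine ⟨min η₀ η₁ / 2, by positivity, ?_, hM _ (by positivity) ?_⟩
  · have := min_le_left η₀ η₁
    linarith
  · have := min_le_right η₀ η₁
    linarith

/-- **S⁺₂ (monotone cooling)**: for some admissible datum the boosts are hot somewhere and the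
bounded-temperature blow-up property at a ceiling is inherited DOWNWARD in `η` (temperature non-increasing
toward the Euler form). The overheating law of the census predicts the opposite monotonicity for every
booster-driven family. -/
def MonotoneCooling : Prop :=
  ∃ 𝒜 : AveragingDatum, 𝒜.IsSymmetric ∧ 𝒜.HasCancellation ∧
    (∃ η M : ℝ, 0 < η ∧ TypeIBlowupFor (boost 𝒜 η) M) ∧
    ∀ η η' M : ℝ, 0 < η' → η' ≤ η → TypeIBlowupFor (boost 𝒜 η) M → TypeIBlowupFor (boost 𝒜 η') M

/-- `MonotoneCooling → Door`. [folklore] -/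
theorem door_of_monotoneCooling (h : MonotoneCooling) : PumpContinuation.EulerProximatePump := by
  obtain ⟨𝒜, hs, hc, ⟨η, M, hη, hM⟩, hmono⟩ := h
  refine door_of_doorFor hs hc ⟨M, fun η₀ hη₀ => ?_⟩
  refine ⟨min η₀ η / 2, by positivity, ?_, hmono η _ M (by positivity) ?_ hM⟩
  · have := min_le_left η₀ η
    linarith
  · have := min_le_right η₀ η
    linarith

end Summit.NavierStokesRegularity.NavierStokesRegularity.Cruxes.EulerProximatePump.Strategist

end
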